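import Literature.Computability.MetaComplexity.PolynomialCalculusResidue
import HarnessLib

/-!
# Residues: Property 1 (iv), `R(1) = 1`, `<_P`-minimality and restrictions (Galesi–Lauria 2010, §2.1, Lemma 5)

Continuation of `PolynomialCalculusResidue.lean` (the semantic residue `residue A p` of a
polynomial modulo the vanishing ideal of a set `A` of Boolean assignments, GL10 §2.1):

* `residue_mul_residue` — Property 1 (iv) `R_E(pq) = R_E(p · R_E(q))`; `residue_one` — `R(1) = 1`
  when `A ≠ ∅` (GL10 proof of Lemma 2, Requirement 3: "`L(1) = R_T(1) = 1` since `T` is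
  satisfiable");
* `pkey q` — the key of the monomial SET of `q` in the colex order (GL10's `<_P` "lexicographically
  extended to polynomials", on multilinear polynomials) and **`pkey_residue_lt`**: the residue is
  the STRICT `<_P`-minimum among multilinear polynomials agreeing with `p` on `A`;
* `restrictBy K ρ` — the `0/1` restriction of a set of variables (`ρ i = some b` restricts `x_i := b`;
  GL10's "u-cta"), `bval_restrictBy`, its action on monomials, and **`pkey_restrictBy_le`** ("a
  restriction can only decrease the order of a polynomial", GL10 proof of Lemma 5);
* the two consequences the degree lower bound uses: **`restrictBy_residue_eq`** (a restriction of
  `R_A(p)` that still agrees with `p` on `A` IS `R_A(p)` — the mechanism of GL10 Lemma 7) and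
  **`residue_eq_residue_of_restrictBy`** (GL10 Lemma 5 in abstract form: if `A ⊆ A'` and a
  restriction of `R_A(p)` agrees with `p` on `A'`, then `R_A(p) = R_{A'}(p)`).

Source: N. Galesi, M. Lauria, *Optimality of size-degree tradeoffs for polynomial calculus*, ACM
ToCL 12(1) (2010), §2.1 Property 1, p. 11 (u-cta, proof of Lemma 5), p. 12 (Lemma 7)
[GalesiLauria2010] (held copy `paper:doi-10-1145-1838552-1838556`).  Design as in the companion
file: any field, any linear order on the variables with well-founded colex on variable sets.
-/

noncomputable section

namespace Literature.Computability.MetaComplexity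

open Finset MvPolynomial

namespace PCResidue

variable {σ : Type*} [LinearOrder σ] {K : Type*} [Field K]

section Residue

variable [WellFoundedLT (Colex (Finset σ))]

/-- Property 1 (iv): `R_A(p · R_A(q)) = R_A(p q)`. [Galesi–Lauria 2010, §2.1 Property 1]
[cite: GalesiLauria2010, §2.1 Property 1] -/
theorem residue_mul_residue (A : Set (σ → Bool)) (p q : MvPolynomial σ K) :
    residue A (p * residue A q) = residue A (p * q) :=
  residue_congr fun x hx => by rw [bval_mul, bval_mul, bval_residue q hx]

/-- `R_A(1) = 1` as soon as `A` is nonempty ("`L(1) = R_T(1) = 1` since `T` is satisfiable").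
[Galesi–Lauria 2010, §3 proof of Lemma 2, Requirement 3] [cite: GalesiLauria2010, Lemma 2] -/
theorem residue_one {A : Set (σ → Bool)} (hA : A.Nonempty) :
    residue A (1 : MvPolynomial σ K) = 1 := by
  classical
  symm
  have hsupp : (1 : MvPolynomial σ K).support = {0} := by
    rw [← C_1, support_C]; exact if_neg one_ne_zero
  refine IsResidue.eq_residue ⟨fun s hs => ?_, fun s hs => ?_, fun x _ => rfl⟩
  · rw [hsupp, Finset.mem_singleton] at hs; subst hs; ext i; simp
  · rw [hsupp, Finset.mem_singleton] at hs
    subst hs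
    intro hmem
    have hbelow : below (0 : σ →₀ ℕ) = ∅ := by
      ext t
      simp only [below, mkey, Finsupp.support_zero, Set.mem_setOf_eq, Set.mem_empty_iff_false,
        iff_false, not_lt]
      rw [show toColex (∅ : Finset σ) = ⊥ from rfl]
      exact bot_le
    rw [hbelow, Set.image_empty, Submodule.span_empty, Submodule.mem_bot] at hmem
    obtain ⟨x, hx⟩ := hA
    have := congrFun hmem ⟨x, hx⟩
    simp [chi] at this

/-! ### The residue is the strict `<_P`-minimum -/

omit [LinearOrder σ] [WellFoundedLT (Colex (Finset σ))] in
/-- The colex key of the monomial set of a polynomial (the polynomial order `<_P` of GL10 §2.1,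
"lexicographically extended to polynomials", on multilinear polynomials). [Galesi–Lauria 2010,
§2.1] [folklore] -/
def pkey (q : MvPolynomial σ K) : Colex (Finset (Colex (Finset σ))) := toColex (q.support.image mkey)

/-- **The residue is the STRICT `<_P`-minimum** among multilinear polynomials that agree with `p`
on `A`. [Galesi–Lauria 2010, §2.1 ("`R_E(q)` … the minimal … polynomial `p` such that
`q - p ∈ Span(E)`")] [cite: GalesiLauria2010, §2.1] -/
theorem pkey_residue_lt {A : Set (σ → Bool)} {p q : MvPolynomial σ K}
    (hml : ∀ s ∈ q.support, MLPC.mlMon s = s) (hagree : ∀ x ∈ A, bval x q = bval x p)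
    (hne : q ≠ residue A p) : pkey (residue A p) < pkey q := by
  classical
  set r := residue A p with hr
  set d := q - r with hd
  have hdne : d ≠ 0 := sub_ne_zero.2 hne
  have hdml : ∀ s ∈ d.support, MLPC.mlMon s = s := fun s hs => by
    rcases Finset.mem_union.1 (support_sub σ q r hs) with h | h
    exacts [hml s h, mlMon_eq_of_mem_support_residue h]
  have hdvan : ∀ x ∈ A, bval x d = 0 := fun x hx => by
    rw [hd, bval_sub, hagree x hx, bval_residue p hx, sub_self]
  have hne' : d.support.Nonempty := by
    rw [Finset.nonempty_iff_ne_empty, ne_eq, support_eq_empty]; exact hdne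
  obtain ⟨s₀, hs₀, hmax⟩ := Finset.exists_max_image d.support mkey hne'
  have hnstd : ¬ IsStd K A s₀ := not_isStd_of_vanish hdml hdvan hs₀ hmax
  have hs₀r : s₀ ∉ r.support := fun h => hnstd (isStd_of_mem_support_residue h)
  have hcoeffd : ∀ s, coeff s d = coeff s q - coeff s r := fun s => by rw [hd, coeff_sub]
  have hs₀q : s₀ ∈ q.support := by
    have h := mem_support_iff.1 hs₀
    rw [hcoeffd, notMem_support_iff.1 hs₀r, sub_zero] at h
    exact mem_support_iff.2 h
  rw [pkey, pkey, Finset.Colex.toColex_lt_toColex_iff_exists_forall_lt]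
  refine ⟨mkey s₀, Finset.mem_image_of_mem _ hs₀q, fun h => ?_, fun b hb hbq => ?_⟩
  · obtain ⟨s', hs', heq⟩ := Finset.mem_image.1 h
    have : s' = s₀ := eq_of_mlMon_of_mkey_eq (mlMon_eq_of_mem_support_residue hs') (hdml s₀ hs₀) heq
    exact hs₀r (this ▸ hs')
  · obtain ⟨s', hs', rfl⟩ := Finset.mem_image.1 hb
    have hs'q : s' ∉ q.support := fun h => hbq (Finset.mem_image_of_mem _ h)
    have hs'd : s' ∈ d.support := by
      rw [mem_support_iff, hcoeffd, notMem_support_iff.1 hs'q, zero_sub, neg_ne_zero]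
      exact mem_support_iff.1 hs'
    refine lt_of_le_of_ne (hmax s' hs'd) fun heq => ?_
    have : s' = s₀ := eq_of_mlMon_of_mkey_eq (hdml s' hs'd) (hdml s₀ hs₀) heq
    exact hs₀r (this ▸ hs')

end Residue

/-! ### Restrictions -/

variable (K) in
omit [LinearOrder σ] in
/-- The `0/1` RESTRICTION of a set of variables: `ρ i = some b` substitutes the Boolean `b` for
`x_i`, `ρ i = none` leaves `x_i` alone (a `K`-algebra endomorphism; GL10's "u-cta" restrictions
are of this form). [Galesi–Lauria 2010, §3 p. 11 (u-cta)] [folklore] -/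
def restrictBy (ρ : σ → Option Bool) : MvPolynomial σ K →ₐ[K] MvPolynomial σ K :=
  bind₁ fun i => (ρ i).elim (X i) fun b => if b then 1 else 0

omit [LinearOrder σ] in
/-- The assignment `x` overridden by the restriction `ρ`. [folklore] -/
def ovr (ρ : σ → Option Bool) (x : σ → Bool) : σ → Bool := fun i => (ρ i).getD (x i)

omit [LinearOrder σ] in
/-- `ovr` at an unrestricted variable. [folklore] -/
theorem ovr_of_none {ρ : σ → Option Bool} {i : σ} (h : ρ i = none) (x : σ → Bool) :
    ovr ρ x i = x i := by
  rw [ovr, h]; rfl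

omit [LinearOrder σ] in
/-- `ovr` at a restricted variable. [folklore] -/
theorem ovr_of_some {ρ : σ → Option Bool} {i : σ} {b : Bool} (h : ρ i = some b) (x : σ → Bool) :
    ovr ρ x i = b := by
  rw [ovr, h]; rfl

omit [LinearOrder σ] in
/-- **Restriction is evaluation at the overridden point.** [folklore] -/
theorem bval_restrictBy (ρ : σ → Option Bool) (x : σ → Bool) (p : MvPolynomial σ K) :
    bval x (restrictBy K ρ p) = bval (ovr ρ x) p := by
  unfold bval restrictBy
  change eval₂Hom (RingHom.id K) _ (bind₁ _ p) = eval₂Hom (RingHom.id K) _ p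
  rw [eval₂Hom_bind₁]
  congr 2
  funext i
  unfold MLPC.boolPoint ovr
  rcases h : ρ i with _ | b
  · simp
  · cases b <;> simp

omit [LinearOrder σ] in
/-- A monomial is KILLED by `ρ` if one of its variables is restricted to `0`. [folklore] -/
def Killed (ρ : σ → Option Bool) (s : σ →₀ ℕ) : Prop := ∃ i ∈ s.support, ρ i = some false

omit [LinearOrder σ] in
/-- The LIVE part of a monomial: its unrestricted variables. [folklore] -/
def live (ρ : σ → Option Bool) (s : σ →₀ ℕ) : σ →₀ ℕ := s.filter fun i => ρ i = none

omit [LinearOrder σ] in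
/-- Support of the live part. [folklore] -/
theorem support_live (ρ : σ → Option Bool) (s : σ →₀ ℕ) :
    (live ρ s).support = s.support.filter fun i => ρ i = none := by
  classical
  rw [live, Finsupp.support_filter]

omit [LinearOrder σ] in
/-- The variables of the live part are unrestricted. [folklore] -/
theorem eq_none_of_mem_support_live {ρ : σ → Option Bool} {s : σ →₀ ℕ} {i : σ}
    (hi : i ∈ (live ρ s).support) : ρ i = none := by
  rw [support_live, Finset.mem_filter] at hi; exact hi.2

omit [LinearOrder σ] in
/-- A monomial none of whose variables is restricted is its own live part. [folklore] -/
theorem live_eq_self {ρ : σ → Option Bool} {s : σ →₀ ℕ} (h : ∀ i ∈ s.support, ρ i = none) :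
    live ρ s = s := by
  classical
  ext i
  rw [live, Finsupp.filter_apply]
  split_ifs with hi
  · rfl
  · exact (Finsupp.notMem_support_iff.1 fun hmem => hi (h i hmem)).symm

omit [LinearOrder σ] in
/-- The live part of a multilinear monomial is multilinear. [folklore] -/
theorem mlMon_live {ρ : σ → Option Bool} {s : σ →₀ ℕ} (hs : MLPC.mlMon s = s) :
    MLPC.mlMon (live ρ s) = live ρ s := by
  classical
  rw [MLPC.mlMon_eq_self_iff] at hs ⊢
  intro i
  rw [live, Finsupp.filter_apply]
  split_ifs
  · exact hs i
  · exact zero_le_one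

omit [LinearOrder σ] in
/-- **Restriction of a monomial**: killed monomials go to `0`, the others to their live part.
[folklore] -/
theorem restrictBy_monomial (ρ : σ → Option Bool) (s : σ →₀ ℕ) (a : K) [Decidable (Killed ρ s)] :
    restrictBy K ρ (monomial s a) = if Killed ρ s then 0 else monomial (live ρ s) a := by
  classical
  rw [restrictBy, bind₁_monomial]
  split_ifs with h
  · obtain ⟨i, hi, hρ⟩ := h
    rw [Finset.prod_eq_zero hi, mul_zero]
    rw [hρ]
    simp [Finsupp.mem_support_iff.1 hi]
  · have hfac : ∀ i ∈ s.support, ((ρ i).elim (X i) fun b => if b then (1 : MvPolynomial σ K)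
        else 0) ^ s i = if ρ i = none then X i ^ s i else 1 := by
      intro i hi
      rcases hρ : ρ i with _ | b
      · simp
      · cases b
        · exact absurd ⟨i, hi, hρ⟩ h
        · simp
    rw [Finset.prod_congr rfl hfac, Finset.prod_ite, Finset.prod_const_one, mul_one,
      monomial_eq, Finsupp.prod, support_live]
    congr 1
    refine Finset.prod_congr rfl fun i hi => ?_
    rw [Finset.mem_filter] at hi
    rw [live, Finsupp.filter_apply, if_pos hi.2]

omit [LinearOrder σ] in
/-- The monomials of a restricted polynomial are live parts of non-killed monomials. [folklore] -/
theorem exists_of_mem_support_restrictBy {ρ : σ → Option Bool} {p : MvPolynomial σ K}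
    {t : σ →₀ ℕ} (ht : t ∈ (restrictBy K ρ p).support) :
    ∃ s ∈ p.support, ¬ Killed ρ s ∧ live ρ s = t := by
  classical
  have h : restrictBy K ρ p = ∑ s ∈ p.support, restrictBy K ρ (monomial s (coeff s p)) := by
    conv_lhs => rw [p.as_sum, map_sum]
  rw [h] at ht
  obtain ⟨s, hs, hts⟩ := Finset.mem_biUnion.1 (support_sum ht)
  rw [restrictBy_monomial] at hts
  split_ifs at hts with hk
  · simp at hts
  · exact ⟨s, hs, hk, (Finset.mem_singleton.1 (support_monomial_subset hts)).symm⟩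

omit [LinearOrder σ] in
/-- The monomials of a restricted polynomial avoid the restricted variables. [folklore] -/
theorem eq_none_of_mem_support_restrictBy {ρ : σ → Option Bool} {p : MvPolynomial σ K}
    {t : σ →₀ ℕ} (ht : t ∈ (restrictBy K ρ p).support) {i : σ} (hi : i ∈ t.support) :
    ρ i = none := by
  obtain ⟨s, -, -, rfl⟩ := exists_of_mem_support_restrictBy ht
  exact eq_none_of_mem_support_live hi

omit [LinearOrder σ] in
/-- Restriction keeps multilinearity. [folklore] -/
theorem mlMon_of_mem_support_restrictBy {ρ : σ → Option Bool} {p : MvPolynomial σ K}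
    (hml : ∀ s ∈ p.support, MLPC.mlMon s = s) {t : σ →₀ ℕ}
    (ht : t ∈ (restrictBy K ρ p).support) : MLPC.mlMon t = t := by
  obtain ⟨s, hs, -, rfl⟩ := exists_of_mem_support_restrictBy ht
  exact mlMon_live (hml s hs)

omit [LinearOrder σ] in
/-- A polynomial not mentioning the restricted variables is fixed ("since `u ∉ Vertex(t)`,
`t|_ρ = t`"). [Galesi–Lauria 2010, proof of Lemma 5] [folklore] -/
theorem restrictBy_eq_self {ρ : σ → Option Bool} {p : MvPolynomial σ K}
    (h : ∀ s ∈ p.support, ∀ i ∈ s.support, ρ i = none) : restrictBy K ρ p = p := by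
  classical
  conv_lhs => rw [p.as_sum, map_sum]
  conv_rhs => rw [p.as_sum]
  refine Finset.sum_congr rfl fun s hs => ?_
  rw [restrictBy_monomial, if_neg, live_eq_self (h s hs)]
  rintro ⟨i, hi, hρ⟩
  rw [h s hs i hi] at hρ
  exact absurd hρ (by simp)

/-- **"A restriction can only decrease the order of a polynomial"** (in the colex key of the
monomial set). [Galesi–Lauria 2010, proof of Lemma 5 (p. 11)]
[cite: GalesiLauria2010, Lemma 5] -/
theorem pkey_restrictBy_le (ρ : σ → Option Bool) (p : MvPolynomial σ K) :
    pkey (restrictBy K ρ p) ≤ pkey p := by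
  classical
  rw [pkey, pkey, Finset.Colex.toColex_le_toColex]
  intro a ha hap
  obtain ⟨t, ht, rfl⟩ := Finset.mem_image.1 ha
  obtain ⟨s, hs, -, hst⟩ := exists_of_mem_support_restrictBy ht
  refine ⟨mkey s, Finset.mem_image_of_mem _ hs, fun hmem => ?_, ?_⟩
  · obtain ⟨t', ht', heq⟩ := Finset.mem_image.1 hmem
    have hsupp : t'.support = s.support := toColex_inj.1 heq
    have hnone : ∀ i ∈ s.support, ρ i = none := fun i hi =>
      eq_none_of_mem_support_restrictBy ht' (hsupp ▸ hi)
    rw [live_eq_self hnone] at hst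
    subst hst
    exact hap (Finset.mem_image_of_mem _ hs)
  · rw [← hst, mkey, mkey, support_live]
    exact Finset.Colex.toColex_le_toColex_of_subset (Finset.filter_subset _ _)

section Residue

variable [WellFoundedLT (Colex (Finset σ))]

/-- **A restriction of `R_A(p)` that still agrees with `p` on `A` is `R_A(p)` itself** (the
mechanism of GL10 Lemma 7: "`R(t) ≤_P R(t)|_ρ <_P R(t)`" is impossible). [Galesi–Lauria 2010,
Lemma 7] [cite: GalesiLauria2010, Lemma 7] -/
theorem restrictBy_residue_eq (ρ : σ → Option Bool) {A : Set (σ → Bool)} {p : MvPolynomial σ K}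
    (h : ∀ x ∈ A, bval x (restrictBy K ρ (residue A p)) = bval x p) :
    restrictBy K ρ (residue A p) = residue A p := by
  by_contra hne
  have hml : ∀ s ∈ (residue A p).support, MLPC.mlMon s = s :=
    fun s hs => mlMon_eq_of_mem_support_residue hs
  have hlt := pkey_residue_lt (fun t ht => mlMon_of_mem_support_restrictBy hml ht) h hne
  exact absurd (lt_of_lt_of_le hlt (pkey_restrictBy_le ρ _)) (lt_irrefl _)

/-- **GL10 Lemma 5, abstract form.** Let `A ⊆ A'` (fewer axioms have more common roots) and
suppose some restriction of `R_A(p)` agrees with `p` on all of `A'`.  Then `R_A(p) = R_{A'}(p)`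
("`R' ≤_P R|_ρ ≤_P R ≤_P R'` by minimality"). [Galesi–Lauria 2010, Lemma 5]
[cite: GalesiLauria2010, Lemma 5] -/
theorem residue_eq_residue_of_restrictBy {A A' : Set (σ → Bool)} (hAA' : A ⊆ A')
    (ρ : σ → Option Bool) {p : MvPolynomial σ K}
    (h : ∀ x ∈ A', bval x (restrictBy K ρ (residue A p)) = bval x p) :
    residue A p = residue A' p := by
  by_contra hne
  have hml : ∀ s ∈ (residue A p).support, MLPC.mlMon s = s :=
    fun s hs => mlMon_eq_of_mem_support_residue hs
  have hml' : ∀ s ∈ (residue A' p).support, MLPC.mlMon s = s :=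
    fun s hs => mlMon_eq_of_mem_support_residue hs
  -- `R_{A'}(p)` agrees with `p` on `A ⊆ A'`, so `R_A(p) <_P R_{A'}(p)`
  have h1 : pkey (residue A p) < pkey (residue A' p) :=
    pkey_residue_lt hml' (fun x hx => bval_residue p (hAA' hx)) (Ne.symm hne)
  -- the restriction agrees with `p` on `A'`, so `R_{A'}(p) ≤_P R_A(p)|_ρ`
  have h2 : pkey (residue A' p) ≤ pkey (restrictBy K ρ (residue A p)) := by
    by_cases heq : restrictBy K ρ (residue A p) = residue A' p
    · rw [heq]
    · exact (pkey_residue_lt (fun t ht => mlMon_of_mem_support_restrictBy hml ht) h heq).le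
  -- and `R_A(p)|_ρ ≤_P R_A(p)`
  have h3 := pkey_restrictBy_le (K := K) ρ (residue A p)
  exact absurd (lt_of_lt_of_le h1 (h2.trans h3)) (lt_irrefl _)

end Residue

end PCResidue

end Literature.Computability.MetaComplexity
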